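import Mathlib
import Summits.Langlands.Langlands.Theses.TorsionKudlaMillsonWindow

/-!
# Piece `TorsionTraceFinite` (stmt-Langlands-18922) of the decomposition of `FTraceCongruenceGeneration` (stmt-Langlands-13533) — birth skeleton

Two stubs: a uniform bound on the order of torsion in `Γ¹ = O¹` (`stub_torsionOrderBound`, cyclotomic
degree bound `φ(n) ≤ 2[K:ℚ]`) and, for each exponent `n`, finiteness of the real parts of the norm-one
units with `uⁿ = 1` (`stub_traceOfPowEqOne`, Cayley–Hamilton: `re u = (ζ + ζ⁻¹)/2` or `±1`).
`TorsionTraceFinite_of` assembles them over the divisors of the bound (no `sorry`).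
-/

set_option linter.dupNamespace false

namespace Summit.Langlands.Langlands.Cruxes.TorsionTraceFinite.Birth

open Summit.Langlands.Langlands.Theses.TorsionKudlaMillsonWindow
open scoped Quaternion

/-- STUB: torsion in `Γ¹` has bounded order. [folklore] -/
theorem stub_torsionOrderBound :
    ∀ (F K : Type) [Field F] [NumberField F] [Field K] [NumberField K] [Algebra F K] (σ : K ≃ₐ[F] K) (a b : NumberField.RingOfIntegers F), NumberField.IsTotallyReal F → Module.finrank F K = 2 → σ ≠ 1 → NumberField.InfinitePlace.nrComplexPlaces K = 1 → a ≠ 0 → b ≠ 0 → (∀ φ : K →+* ℂ, (starRingEnd ℂ).comp φ = φ → (φ (algebraMap F K a)).re < 0 ∧ (φ (algebraMap F K b)).re < 0) → (∀ φ : K →+* ℂ, (starRingEnd ℂ).comp φ ≠ φ → 0 < (φ (algebraMap F K a)).re ∨ 0 < (φ (algebraMap F K b)).re) → let a' : K := algebraMap F K a; let b' : K := algebraMap F K b; (∀ y : QuaternionAlgebra K a' 0 b', y * star y = 0 → y = 0) → let IsInt : QuaternionAlgebra K a' 0 b' → Prop := fun x => ∀ i : Fin 4, QuaternionAlgebra.equivTuple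 a' 0 b' x i ∈ Set.range (algebraMap (NumberField.RingOfIntegers K) K); let IsG : (QuaternionAlgebra K a' 0 b')ˣ → Prop := fun u => IsInt (u : QuaternionAlgebra K a' 0 b') ∧ IsInt ((u⁻¹ : (QuaternionAlgebra K a' 0 b')ˣ) : QuaternionAlgebra K a' 0 b'); ∃ n₀ : ℕ, 0 < n₀ ∧ ∀ u : (QuaternionAlgebra K a' 0 b')ˣ, IsG u → (u : QuaternionAlgebra K a' 0 b') * star (u : QuaternionAlgebra K a' 0 b') = 1 → IsOfFinOrder u → orderOf u ∣ n₀ := by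
  sorry

/-- STUB: for fixed `n`, the real parts of norm-one units of `O` with `uⁿ = 1` form a finite set. [folklore] -/
theorem stub_traceOfPowEqOne :
    ∀ (F K : Type) [Field F] [NumberField F] [Field K] [NumberField K] [Algebra F K] (σ : K ≃ₐ[F] K) (a b : NumberField.RingOfIntegers F), NumberField.IsTotallyReal F → Module.finrank F K = 2 → σ ≠ 1 → NumberField.InfinitePlace.nrComplexPlaces K = 1 → a ≠ 0 → b ≠ 0 → (∀ φ : K →+* ℂ, (starRingEnd ℂ).comp φ = φ → (φ (algebraMap F K a)).re < 0 ∧ (φ (algebraMap F K b)).re < 0) → (∀ φ : K →+* ℂ, (starRingEnd ℂ).comp φ ≠ φ → 0 < (φ (algebraMap F K a)).re ∨ 0 < (φ (algebraMap F K b)).re) → let a' : K := algebraMap F K a; let b' : K := algebraMap F K b; (∀ y : QuaternionAlgebra K a' 0 b', y * star y = 0 → y = 0) → let IsInt : QuaternionAlgebra K a' 0 b' → Prop := fun x => ∀ i : Fin 4, QuaternionAlgebra.equivTuple a' 0 b' x i ∈ Set.range (algebraMap (NumberField.RingOfIntegers K) K); let IsG : (QuaternionAlgebra K a' 0 b')ˣ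 → Prop := fun u => IsInt (u : QuaternionAlgebra K a' 0 b') ∧ IsInt ((u⁻¹ : (QuaternionAlgebra K a' 0 b')ˣ) : QuaternionAlgebra K a' 0 b'); ∀ n : ℕ, 0 < n → ∃ Tn : Finset K, ∀ u : (QuaternionAlgebra K a' 0 b')ˣ, IsG u → (u : QuaternionAlgebra K a' 0 b') * star (u : QuaternionAlgebra K a' 0 b') = 1 → u ^ n = 1 → (u : QuaternionAlgebra K a' 0 b').re ∈ Tn := by
  sorry

/-! ## Name-keyed aliases of the two stub statements — the hypotheses of `TorsionTraceFinite_of`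

The native skeleton audit (`#h21_check_skeleton`, run by `ledger skeleton check`) admits a hypothesis of the
composing theorem only if its head constant is a registered obligation or is NAMED like a declared stub;
`__Registered.stub_X` is the statement of `stub_X` verbatim (same source text) under the stub's short name
(device of `AnomalousDissipation/…/Cruxes/CyclicWindLineLoud/Lines/birth.lean`; the gate-reserved `@[stub]`
attribute is not written by a planner). -/
namespace __Registered

/-- Alias of the statement of `stub_torsionOrderBound`, keyed by the stub name. -/
abbrev stub_torsionOrderBound : Prop :=
  ∀ (F K : Type) [Field F] [NumberField F] [Field K] [NumberField K] [Algebra F K] (σ : K ≃ₐ[F] K) (a b : NumberField.RingOfIntegers F), NumberField.IsTotallyReal F → Module.finrank F K = 2 → σ ≠ 1 → NumberField.InfinitePlace.nrComplexPlaces K = 1 → a ≠ 0 → b ≠ 0 → (∀ φ : K →+* ℂ, (starRingEnd ℂ).comp φ = φ → (φ (algebraMap F K a)).re < 0 ∧ (φ (algebraMap F K b)).re < 0) → (∀ φ : K →+* ℂ, (starRingEnd ℂ).comp φ ≠ φ → 0 < (φ (algebraMap F K a)).re ∨ 0 < (φ (algebraMap F K b)).re) → let a' : K := algebraMap F K a;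 let b' : K := algebraMap F K b; (∀ y : QuaternionAlgebra K a' 0 b', y * star y = 0 → y = 0) → let IsInt : QuaternionAlgebra K a' 0 b' → Prop := fun x => ∀ i : Fin 4, QuaternionAlgebra.equivTuple a' 0 b' x i ∈ Set.range (algebraMap (NumberField.RingOfIntegers K) K); let IsG : (QuaternionAlgebra K a' 0 b')ˣ → Prop := fun u => IsInt (u : QuaternionAlgebra K a' 0 b') ∧ IsInt ((u⁻¹ : (QuaternionAlgebra K a' 0 b')ˣ) : QuaternionAlgebra K a' 0 b'); ∃ n₀ : ℕ, 0 < n₀ ∧ ∀ u : (QuaternionAlgebra K a' 0 b')ˣ, IsG u → (u : QuaternionAlgebra K a' 0 b') * star (u : QuaternionAlgebra K a' 0 b') = 1 → IsOfFinOrder u → orderOf u ∣ n₀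

/-- Alias of the statement of `stub_traceOfPowEqOne`, keyed by the stub name. -/
abbrev stub_traceOfPowEqOne : Prop :=
  ∀ (F K : Type) [Field F] [NumberField F] [Field K] [NumberField K] [Algebra F K] (σ : K ≃ₐ[F] K) (a b : NumberField.RingOfIntegers F), NumberField.IsTotallyReal F → Module.finrank F K = 2 → σ ≠ 1 → NumberField.InfinitePlace.nrComplexPlaces K = 1 → a ≠ 0 → b ≠ 0 → (∀ φ : K →+* ℂ, (starRingEnd ℂ).comp φ = φ → (φ (algebraMap F K a)).re < 0 ∧ (φ (algebraMap F K b)).re < 0) → (∀ φ : K →+* ℂ, (starRingEnd ℂ).comp φ ≠ φ → 0 < (φ (algebraMap F K a)).re ∨ 0 < (φ (algebraMap F K b)).re) → let a' : K := algebraMap F K a; let b' : K := algebraMap F K b; (∀ y : QuaternionAlgebra K a' 0 b', y * star y = 0 → y = 0) → let IsInt : QuaternionAlgebra K a' 0 b' → Prop := fun x => ∀ i : Fin 4, QuaternionAlgebra.equivTuple a' 0 b' x i ∈ Set.range (algebraMap (NumberField.RingOfIntegers K) K); let IsG : (QuaternionAlgebra K a' 0 b')ˣ → Prop := fun u => IsInt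 (u : QuaternionAlgebra K a' 0 b') ∧ IsInt ((u⁻¹ : (QuaternionAlgebra K a' 0 b')ˣ) : QuaternionAlgebra K a' 0 b'); ∀ n : ℕ, 0 < n → ∃ Tn : Finset K, ∀ u : (QuaternionAlgebra K a' 0 b')ˣ, IsG u → (u : QuaternionAlgebra K a' 0 b') * star (u : QuaternionAlgebra K a' 0 b') = 1 → u ^ n = 1 → (u : QuaternionAlgebra K a' 0 b').re ∈ Tn

end __Registered

/-- **Composition** (kernel-checked, no `sorry` of its own): the two stub statements (as the name-keyed aliases
`__Registered.stub_*`) imply the piece `TorsionTraceFinite` BY NAME. [folklore] -/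
theorem TorsionTraceFinite_of :
    __Registered.stub_torsionOrderBound → __Registered.stub_traceOfPowEqOne →
      Summit.Langlands.Langlands.Theses.TorsionKudlaMillsonWindow.TorsionTraceFinite := by
  intro hA hB
  dsimp only [__Registered.stub_torsionOrderBound, __Registered.stub_traceOfPowEqOne] at hA hB
  intro F K _ _ _ _ _ σ a b hF hK2 hσ hcx ha hb hneg hpos a' b' hdiv IsInt IsG
  obtain ⟨n₀, hn₀, hord⟩ := hA F K σ a b hF hK2 hσ hcx ha hb hneg hpos hdiv
  have hB' := hB F K σ a b hF hK2 hσ hcx ha hb hneg hpos hdiv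
  classical
  choose Tn hTn using hB'
  refine ⟨(Nat.divisors n₀).biUnion (fun n => if h : 0 < n then Tn n h else ∅), ?_⟩
  intro u hu hu1 hfin
  have hpos' : 0 < orderOf u := hfin.orderOf_pos
  have hdvd : orderOf u ∣ n₀ := hord u hu hu1 hfin
  rw [Finset.mem_biUnion]
  refine ⟨orderOf u, Nat.mem_divisors.mpr ⟨hdvd, hn₀.ne'⟩, ?_⟩
  rw [dif_pos hpos']
  exact hTn (orderOf u) hpos' u hu hu1 (pow_orderOf_eq_one u)

/-- WIRING CHECK: the two sorried stubs compose to a closed term of the piece's type (modulo their `sorry`s);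
an `example`, so no pre-composed constant of type `TorsionTraceFinite` enters an importing environment. -/
example : Summit.Langlands.Langlands.Theses.TorsionKudlaMillsonWindow.TorsionTraceFinite :=
  TorsionTraceFinite_of stub_torsionOrderBound stub_traceOfPowEqOne

end Summit.Langlands.Langlands.Cruxes.TorsionTraceFinite.Birth
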